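import Summits.QuantumFields.BalabanUV.Beta.D1BFx.HessKerConjugation
import Summits.QuantumFields.BalabanUV.Beta.SymCorrectorSlot
import Summits.QuantumFields.BalabanUV.Beta.SecondOrderRemainderTables

/-!
# `BalabanUV.Beta.D1BFx.ChartDefectWords` — road «BF-x», row D1, the (J1) program: **W-3 «THE CHART DEFECT IS THREE ONE-LOOP WORDS AT THE
# ROAD's OWN KERNEL»** (`HOME/b2b-balaban-beta-d1-p2/J1-DEFECT-WORDS.md` v0.1 §2–§4, OWNER-MEMO-g22 v3 §3″.1; an2 RULING R-D1-g43-3 (2):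
# «(J1) := the ONE ROW `hC₁ := Δ_n`, to be OPENED into words — the road writes the defect expansion, the dictionary supplies the letters»).

THE MATHEMATICS.  The chart-(III′) literal of record reads, at one blocking of odd size `n`, `TOf (JsB12CombShSym … 0) = hessKer G′ (vertexOfK G′ n S⁰) W⁰`
with `G′ := GcombSh n 0` and the RAW jets `(S⁰, W⁰) := JsB12CombSh0 … 0` (`CombChartJointEnd.TbalOf_JsB12CombShSym`), while road «BF-x» reads its own
functional at `G₀ := coDressKBmAt ρ_c n (KInvStep n 0)` (PART 22∕23-hyb).  leaf-03's CHART TRANSPORT (`SymCorrectorTransport.GcombSh_zero_eq_conj_psiKS_KInvStep`)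
says `G′ = Ψ̂ ∘ G₀ ∘ Ψ̂ᵀ`, `Ψ̂ := psiKS (ctrOff (d+1) n) n` (the kernelised symmetrised corrector; block-local, identity on the multiplier block).  Hence:
* §1 (T1) TRANSPORT — for ANY spread `K`, root offset `r ∈ box (d+1) n`, local stencil family `S` and localised second-order family `W′`:
  `hessKer (Ψ̂KΨ̂ᵀ) (vertexOfK (Ψ̂KΨ̂ᵀ) n S) W′ μ ν z = hessKer K (μ y ↦ Ψ̂ᵀ∘vertexOfK K n (slotPsiS r n S) μ y∘Ψ̂) (μ y ν y′ ↦ Ψ̂ᵀ∘W′ μ y ν y′∘Ψ̂) μ ν z`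
  (the OWNER's `HessKerConjugation.hessKer_conj_kernel` = (T-leg) + leaf-03's slot adjunction `SymCorrectorSlot.vertexOfK_conj_psiKS` = W-3′);
* §2 (T2) THE WORDS — against ANY reference second-order family `W` at `K`:
  `hessKer (Ψ̂KΨ̂ᵀ) (vertexOfK (Ψ̂KΨ̂ᵀ) n S) W′ − hessKer K (vertexOfK K n S) W = ½·tadpole K (Wᵈ μ 0 ν z) − ½·(bubble K (V μ 0) (Vᵈ ν z) + bubble K (Vᵈ μ 0) (V ν z))
  − ½·bubble K (Vᵈ μ 0) (Vᵈ ν z)` — (D-T)(+ (D-R)) ∕ (D-X) ∕ (D-C) of the words file §4 — with `V := vertexOfK K n S`,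
  **`Vᵈ μ y := Ψ̂ᵀ∘vertexOfK K n (slotPsiS r n S) μ y∘Ψ̂ − V μ y`**, **`Wᵈ μ y ν y′ := Ψ̂ᵀ∘W′ μ y ν y′∘Ψ̂ − W μ y ν y′`** (`hessKer_add_add_sub`);
* §3 (T3) THE FIRST-ORDER DEFECT VERTEX DECOMPOSED: `Vᵈ μ y = (Ψ̂ᵀ∘V μ y∘Ψ̂ − V μ y) + Ψ̂ᵀ∘vertexOfK K n S^face μ y∘Ψ̂`, `S^face α x := faceWt r n α x • faceSum n S (blk n x)`
  (leaf-03's `vertexOfK_conj_psiKS_eq_add`) — LEG WORDS of the raw vertex + the fully dressed FACE vertex; the four fibre blocks of a leg-dressed kernel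
  `Ψ̂ᵀ∘X∘Ψ̂` written by leaf-03's leg letters (ff: `slotPsiS` on both field legs, fm ∕ mf: on one, mm: untouched);
* (T4) THE LITERAL and PART 23-hyb's `RJ1` on the scales, word by word: the companion file `D1BFx/ChartDefectWordsLiteral` (split for the 400-line rule);
  the literal's W slot is kept WHOLE there (`Wᵈ = Ψ̂ᵀW⁰Ψ̂ − W`): its split into `W₂^face` + the `mixOfK` ∕ `dM∘K2OfK` words is the W-rest supplier's
  (leaf-03 TT4 `vertex2OfK_conj_psiKS`, TT6 `SymCorrectorRest`).

HONEST DEPENDENCY (cell records, verbatim): «continuum YM on T⁴ ⇐ BetaPertH ∧ nine spine estimates (0/9 proved); BetaPertH ⇐ (D1) ∧ (D4) ∧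
CAP+tail; G-an2-4 gates asym, D1 and NE2/3/4.»  HONEST FRAMING (cell contract, verbatim): «discharging `BetaPertH` makes Bałaban's UV stability
UNCONDITIONAL — a real constructive-QFT result; it is NOT the continuum limit and NOT the Clay problem.»  THIS MODULE DISCHARGES NOTHING of (K), of
(J1)'s row, of D1 or of the wall: [folklore] exact identities between OUR kernels (conjugation, tame associativity, finite face sums) BY NAME; it prices NO
row ((R-c1)(R-c2) untouched), asserts no currency, proves NO clause of B12 Thm 2 ∕ Erice and NO estimate of Bałaban's.  No definition, no `def … : Prop`,
nothing cited, 0 sorry.  0∕4 row-D1 binders (hW ∕ hR ∕ D1Tel ∕ D1Rep); (K) NOT closed; (J1) = ONE OPEN ROW; NOT D1, NEVER «G-an2-4 closed», NOT `BetaPertH`,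
NOT continuum, NOT Clay.

ABSOLUTE RULE (cell charter, verbatim): «No internally-minted statement may enter as a cited fact. Every hypothesis is either kernel-proved in this
package or a verbatim quotation of a PUBLISHED theorem with page reference. The manuscript(s) under audit are NOT citable for their own disputed
steps — they are the thing under adjudication; programme-internal (2001/route/tribunal) claims are never citable.»

Unit `b2b-balaban-beta-d1-p2` (road owner, gen 23), 2026-08-23; over leaf-03 g28∕g29's `SymCorrectorTransport` ∕ `SymCorrectorSlot` and the owner's
`HessKerConjugation` BY NAME; no existing file touched.
-/

noncomputable section

namespace Summit.QuantumFields.BalabanUV.Beta.D1BFx.ChartDefectWords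

open Literature.MathematicalPhysics.QuantumFieldTheory
open Literature.MathematicalPhysics.QuantumFieldTheory.Balaban1983to89
open Literature.MathematicalPhysics.QuantumFieldTheory.Balaban1983to89.Beta
open B12Sec2to5 (l1 l1_nonneg)
open ExpKernelCalculus (MKer Decays BiLoc comp tadpole bubble hessKer)
open OneStepResolventKernel (Fib JetData LocStencil decays_mono biLoc_mono)
open OneStepKernelFamily (vertexOfK vertexFamily_vertexOfK')
open SecondOrderResponse (vertex2OfK)
open BalabanCompositeJets (LocStencil₂)
open AffineAveraging (Site box toSite)
open AveragingContours (blk)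
open Summit.QuantumFields.BalabanUV.Beta.TameKernelCalculus
open Summit.QuantumFields.BalabanUV.Beta.ChartConjugationRelative (spr_comp)
open Summit.QuantumFields.BalabanUV.Beta.SymCorrectorKernel (psiKS spr_psiKS)
open Summit.QuantumFields.BalabanUV.Beta.SymCorrectorFace (faceWt faceSum slotPsiS)
open Summit.QuantumFields.BalabanUV.Beta.SymCorrectorSlot (vertexOfK_conj_psiKS vertexOfK_conj_psiKS_eq_add comp_trK_psiKS_inl_left
  comp_trK_psiKS_inr_left comp_psiKS_inl_right comp_psiKS_inr_right)
open Summit.QuantumFields.BalabanUV.Beta.D1BFx.HessKerConjugation (hessKer_conj_kernel hessKer_add_add_sub)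
open Summit.QuantumFields.BalabanUV.Beta.SecondOrderRemainderTables (loc_vertex2OfK)

variable {d : ℕ}

/-! ## §0 Localisation bookkeeping (sockets of `hessKer_conj_kernel` ∕ `hessKer_add_add_sub`) -/

section Loc

variable {n : ℕ} {K : MKer (d + 1) (Fib d)} {S : Fin (d + 1) → (Fin (d + 1) → ℤ) → MKer (d + 1) (Fib d)} {Cs δs : ℝ}

/-- [folklore] The chain-rule vertex of a local stencil family through a spread kernel is a localised kernel. -/
theorem loc_vertexOfK_of_spr (hK : Spr K) (hS : LocStencil S Cs δs) (hδs : 0 < δs) (μ : Fin (d + 1)) (y : Fin (d + 1) → ℤ) :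
    Loc (vertexOfK K n S μ y) := by
  obtain ⟨C, δ, hδ, hKd⟩ := hK
  obtain ⟨Cv, δv, hδv, hV⟩ := vertexFamily_vertexOfK' (N := n) ⟨δ, C, hδ, hKd.nonneg (Sum.inl 0), hKd⟩ hS hδs
  exact ⟨_, _, Cv, δv, hδv, hV μ y⟩

/-- [folklore] A leg-dressed localised kernel `Pᵀ∘X∘P` (spread `P`) is localised. -/
theorem loc_legDress {P X : MKer (d + 1) (Fib d)} (hP : Spr P) (hX : Loc X) : Loc (comp (comp (trK P) X) P) :=
  (hP.trK.comp_loc hX).comp_spr hP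

/-- [folklore] The second-order vertex of a jet datum is localised. -/
theorem loc_jetData_W [NeZero n] (J : JetData d n) (μ : Fin (d + 1)) (y : Fin (d + 1) → ℤ) (ν : Fin (d + 1)) (y' : Fin (d + 1) → ℤ) :
    Loc (J.W μ y ν y') :=
  ⟨_, _, _, _, J.δ_pos, J.loc₂ μ y ν y'⟩

/-- [folklore] The one-shot second-order vertex of a `LocStencil₂` family through a spread kernel is localised (an2's `loc_vertex2OfK` at the common rate). -/
theorem loc_vertex2OfK_of_spr (hK : Spr K) {S₂ : Fin (d + 1) → (Fin (d + 1) → ℤ) → Fin (d + 1) → (Fin (d + 1) → ℤ) → MKer (d + 1) (Fib d)}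
    {C₂ δ₂ : ℝ} (hS₂ : LocStencil₂ S₂ C₂ δ₂) (hC₂ : 0 ≤ C₂) (hδ₂ : 0 < δ₂) (μ : Fin (d + 1)) (y : Fin (d + 1) → ℤ) (ν : Fin (d + 1))
    (y' : Fin (d + 1) → ℤ) : Loc (vertex2OfK K n S₂ μ y ν y') := by
  obtain ⟨C, δ, hδ, hKd⟩ := hK
  have hC : 0 ≤ C := hKd.nonneg (Sum.inl 0)
  have hm : 0 < min δ δ₂ := lt_min hδ hδ₂
  have hK' : Decays K C (min δ δ₂) := decays_mono hKd hC le_rfl (min_le_left _ _)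
  have hS₂' : LocStencil₂ S₂ C₂ (min δ δ₂) := by
    intro κ u κ' u'
    have h1 : BiLoc (S₂ κ u κ' u') u u (C₂ * Real.exp (-(min δ δ₂) * l1 (u' - u))) δ₂ := fun x w c b => by
      refine (hS₂ κ u κ' u' x w c b).trans (mul_le_mul_of_nonneg_right ?_ (Real.exp_pos _).le)
      exact mul_le_mul_of_nonneg_left (Real.exp_le_exp.2 (by nlinarith [l1_nonneg (u' - u), min_le_right δ δ₂])) hC₂
    exact biLoc_mono h1 (by positivity) (min_le_right _ _)
  exact loc_vertex2OfK (N := n) hK' hC hm hS₂' μ y ν y'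

end Loc

/-! ## §1 (T1) TRANSPORT: the one-loop functional at the conjugated kernel, with ITS OWN chain-rule vertex, read at `K` -/

section Transport

variable {n : ℕ} (hn : 0 < n) {r : Fin (d + 1) → ℕ} (hr : r ∈ box (d + 1) n)
  {K : MKer (d + 1) (Fib d)} (hK : Spr K)
  {S : Fin (d + 1) → (Fin (d + 1) → ℤ) → MKer (d + 1) (Fib d)} {Cs δs : ℝ} (hS : LocStencil S Cs δs) (hδs : 0 < δs)
include hn hr hK hS hδs

/-- [folklore] The slot adjunction as an equality of vertex FAMILIES (leaf-03's `vertexOfK_conj_psiKS` under `funext`). -/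
theorem vertexOfK_conj_psiKS_family :
    vertexOfK (comp (comp (psiKS r n) K) (trK (psiKS r n))) n S = vertexOfK K n (slotPsiS r n S) :=
  funext fun μ => funext fun y => vertexOfK_conj_psiKS hn hr hK hS hδs μ y

/-- [folklore] The slot-transported vertex is localised (it IS the vertex through the conjugated spread kernel). -/
theorem loc_vertexOfK_slotPsiS (μ : Fin (d + 1)) (y : Fin (d + 1) → ℤ) : Loc (vertexOfK K n (slotPsiS r n S) μ y) := by
  rw [← vertexOfK_conj_psiKS hn hr hK hS hδs μ y]
  exact loc_vertexOfK_of_spr (spr_comp (spr_comp (spr_psiKS hn hr) hK) (spr_psiKS hn hr).trK) hS hδs μ y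

/-- [folklore] **(T1) TRANSPORT.**  For spread `K`, `Ψ̂ := psiKS r n` (`0 < n`, `r ∈ box (d+1) n`), a local stencil family `S` (`0 < δs`) and ANY localised
second-order family `W′`:
`hessKer (Ψ̂∘K∘Ψ̂ᵀ) (vertexOfK (Ψ̂∘K∘Ψ̂ᵀ) n S) W′ μ ν z = hessKer K (μ y ↦ Ψ̂ᵀ∘vertexOfK K n (slotPsiS r n S) μ y∘Ψ̂) (μ y ν y′ ↦ Ψ̂ᵀ∘W′ μ y ν y′∘Ψ̂) μ ν z` —
the literal-side functional IS the road's functional at `K` on the slot-transported, leg-dressed jets ((T-leg) `hessKer_conj_kernel` + W-3′ `vertexOfK_conj_psiKS`). -/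
theorem hessKer_conj_psiKS_vertexOfK (W' : Fin (d + 1) → (Fin (d + 1) → ℤ) → Fin (d + 1) → (Fin (d + 1) → ℤ) → MKer (d + 1) (Fib d))
    (hW' : ∀ μ y ν y', Loc (W' μ y ν y')) (μ ν : Fin (d + 1)) (z : Fin (d + 1) → ℤ) :
    hessKer (comp (comp (psiKS r n) K) (trK (psiKS r n))) (vertexOfK (comp (comp (psiKS r n) K) (trK (psiKS r n))) n S) W' μ ν z
      = hessKer K (fun μ' y => comp (comp (trK (psiKS r n)) (vertexOfK K n (slotPsiS r n S) μ' y)) (psiKS r n))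
          (fun μ' y ν' y' => comp (comp (trK (psiKS r n)) (W' μ' y ν' y')) (psiKS r n)) μ ν z := by
  have hΨ : Spr (psiKS r n) := spr_psiKS hn hr
  rw [vertexOfK_conj_psiKS_family hn hr hK hS hδs]
  exact hessKer_conj_kernel hΨ hK (loc_vertexOfK_slotPsiS hn hr hK hS hδs) hW' μ ν z

/-! ## §2 (T2) THE WORDS: the defect against the road's functional at `K` with ANY reference second-order family -/

omit hn hr hK hS hδs in
/-- [folklore] The leg-dressed transported first-order family is the raw vertex plus the DEFECT VERTEX `Vᵈ` (pointwise bookkeeping). -/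
theorem legDress_vertexOfK_slotPsiS_eq_add :
    (fun μ' y => comp (comp (trK (psiKS r n)) (vertexOfK K n (slotPsiS r n S) μ' y)) (psiKS r n))
      = vertexOfK K n S + fun μ' y => comp (comp (trK (psiKS r n)) (vertexOfK K n (slotPsiS r n S) μ' y)) (psiKS r n) - vertexOfK K n S μ' y := by
  funext μ' y
  simp only [Pi.add_apply]
  abel

omit hn hr hK hS hδs in
/-- [folklore] The leg-dressed second-order family is the reference family plus the DEFECT `Wᵈ` (pointwise bookkeeping). -/
theorem legDress_W_eq_add (W' W : Fin (d + 1) → (Fin (d + 1) → ℤ) → Fin (d + 1) → (Fin (d + 1) → ℤ) → MKer (d + 1) (Fib d)) :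
    (fun μ' y ν' y' => comp (comp (trK (psiKS r n)) (W' μ' y ν' y')) (psiKS r n))
      = W + fun μ' y ν' y' => comp (comp (trK (psiKS r n)) (W' μ' y ν' y')) (psiKS r n) - W μ' y ν' y' := by
  funext μ' y ν' y'
  simp only [Pi.add_apply]
  abel

/-- [folklore] The defect vertex `Vᵈ μ y := Ψ̂ᵀ∘vertexOfK K n (slotPsiS r n S) μ y∘Ψ̂ − vertexOfK K n S μ y` is localised. -/
theorem loc_defectVertex (μ : Fin (d + 1)) (y : Fin (d + 1) → ℤ) :
    Loc (comp (comp (trK (psiKS r n)) (vertexOfK K n (slotPsiS r n S) μ y)) (psiKS r n) - vertexOfK K n S μ y) :=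
  (loc_legDress (spr_psiKS hn hr) (loc_vertexOfK_slotPsiS hn hr hK hS hδs μ y)).sub (loc_vertexOfK_of_spr hK hS hδs μ y)

omit hK hS hδs in
/-- [folklore] The second-order defect `Wᵈ := Ψ̂ᵀ∘W′∘Ψ̂ − W` is localised. -/
theorem loc_defectW {W' W : Fin (d + 1) → (Fin (d + 1) → ℤ) → Fin (d + 1) → (Fin (d + 1) → ℤ) → MKer (d + 1) (Fib d)}
    (hW' : ∀ μ y ν y', Loc (W' μ y ν y')) (hW : ∀ μ y ν y', Loc (W μ y ν y')) (μ : Fin (d + 1)) (y : Fin (d + 1) → ℤ) (ν : Fin (d + 1))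
    (y' : Fin (d + 1) → ℤ) : Loc (comp (comp (trK (psiKS r n)) (W' μ y ν y')) (psiKS r n) - W μ y ν y') :=
  (loc_legDress (spr_psiKS hn hr) (hW' μ y ν y')).sub (hW μ y ν y')

/-- [folklore] **(T2) THE CHART DEFECT IS THREE ONE-LOOP WORDS AT `K`** (`J1-DEFECT-WORDS.md` §4 as a theorem).  With `Ψ̂ := psiKS r n`, `V := vertexOfK K n S`,
`Vᵈ μ y := Ψ̂ᵀ∘vertexOfK K n (slotPsiS r n S) μ y∘Ψ̂ − V μ y`, `Wᵈ μ y ν y′ := Ψ̂ᵀ∘W′ μ y ν y′∘Ψ̂ − W μ y ν y′`, for ANY localised `W′` (the literal's second-order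
slot) and ANY localised reference `W` (the road's):
`hessKer (Ψ̂KΨ̂ᵀ) (vertexOfK (Ψ̂KΨ̂ᵀ) n S) W′ μ ν z − hessKer K V W μ ν z = ½·tadpole K (Wᵈ μ 0 ν z) − ½·(bubble K (V μ 0) (Vᵈ ν z) + bubble K (Vᵈ μ 0) (V ν z))
− ½·bubble K (Vᵈ μ 0) (Vᵈ ν z)` — (D-T)(with (D-R) inside) ∕ (D-X) ∕ (D-C). -/
theorem chartDefect_eq_words (W' W : Fin (d + 1) → (Fin (d + 1) → ℤ) → Fin (d + 1) → (Fin (d + 1) → ℤ) → MKer (d + 1) (Fib d))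
    (hW' : ∀ μ y ν y', Loc (W' μ y ν y')) (hW : ∀ μ y ν y', Loc (W μ y ν y')) (μ ν : Fin (d + 1)) (z : Fin (d + 1) → ℤ) :
    hessKer (comp (comp (psiKS r n) K) (trK (psiKS r n))) (vertexOfK (comp (comp (psiKS r n) K) (trK (psiKS r n))) n S) W' μ ν z
        - hessKer K (vertexOfK K n S) W μ ν z
      = (1 / 2) * tadpole K (comp (comp (trK (psiKS r n)) (W' μ 0 ν z)) (psiKS r n) - W μ 0 ν z)
        - (1 / 2) * (bubble K (vertexOfK K n S μ 0)
              (comp (comp (trK (psiKS r n)) (vertexOfK K n (slotPsiS r n S) ν z)) (psiKS r n) - vertexOfK K n S ν z)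
            + bubble K (comp (comp (trK (psiKS r n)) (vertexOfK K n (slotPsiS r n S) μ 0)) (psiKS r n) - vertexOfK K n S μ 0)
              (vertexOfK K n S ν z))
        - (1 / 2) * bubble K (comp (comp (trK (psiKS r n)) (vertexOfK K n (slotPsiS r n S) μ 0)) (psiKS r n) - vertexOfK K n S μ 0)
            (comp (comp (trK (psiKS r n)) (vertexOfK K n (slotPsiS r n S) ν z)) (psiKS r n) - vertexOfK K n S ν z) := by
  rw [hessKer_conj_psiKS_vertexOfK hn hr hK hS hδs W' hW' μ ν z, legDress_vertexOfK_slotPsiS_eq_add, legDress_W_eq_add W' W]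
  exact hessKer_add_add_sub hK (loc_vertexOfK_of_spr hK hS hδs) (loc_defectVertex hn hr hK hS hδs) hW (loc_defectW hn hr hW' hW) μ ν z

/-! ## §3 (T3) THE DEFECT VERTEX DECOMPOSED: leg words of the raw vertex + the dressed face vertex -/

/-- [folklore] The FACE VERTEX `vertexOfK K n S^face μ y`, `S^face α x := faceWt r n α x • faceSum n S (blk n x)`, is the slot-transported vertex minus the
raw one (leaf-03's `vertexOfK_conj_psiKS_eq_add` rearranged) … -/
theorem vertexOfK_face_eq_sub (μ : Fin (d + 1)) (y : Fin (d + 1) → ℤ) :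
    vertexOfK K n (fun α x => faceWt r n α x • faceSum n S (blk n x)) μ y = vertexOfK K n (slotPsiS r n S) μ y - vertexOfK K n S μ y := by
  rw [← vertexOfK_conj_psiKS hn hr hK hS hδs μ y, vertexOfK_conj_psiKS_eq_add hn hr hK hS hδs μ y, add_sub_cancel_left]

/-- [folklore] … hence localised. -/
theorem loc_vertexOfK_face (μ : Fin (d + 1)) (y : Fin (d + 1) → ℤ) : Loc (vertexOfK K n (fun α x => faceWt r n α x • faceSum n S (blk n x)) μ y) := by
  rw [vertexOfK_face_eq_sub hn hr hK hS hδs μ y]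
  exact (loc_vertexOfK_slotPsiS hn hr hK hS hδs μ y).sub (loc_vertexOfK_of_spr hK hS hδs μ y)

/-- [folklore] **(T3) `Vᵈ = LEG WORDS + DRESSED FACE VERTEX`**: `Ψ̂ᵀ∘vertexOfK K n (slotPsiS r n S) μ y∘Ψ̂ − V μ y = (Ψ̂ᵀ∘V μ y∘Ψ̂ − V μ y) + Ψ̂ᵀ∘vertexOfK K n S^face μ y∘Ψ̂`
(W-3′ in the owner's shape `V + V^face`, then tame distributivity of the leg dressing). -/
theorem defectVertex_eq_legs_add_face (μ : Fin (d + 1)) (y : Fin (d + 1) → ℤ) :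
    comp (comp (trK (psiKS r n)) (vertexOfK K n (slotPsiS r n S) μ y)) (psiKS r n) - vertexOfK K n S μ y
      = (comp (comp (trK (psiKS r n)) (vertexOfK K n S μ y)) (psiKS r n) - vertexOfK K n S μ y)
        + comp (comp (trK (psiKS r n)) (vertexOfK K n (fun α x => faceWt r n α x • faceSum n S (blk n x)) μ y)) (psiKS r n) := by
  have hΨ : Spr (psiKS r n) := spr_psiKS hn hr
  have hV : Loc (vertexOfK K n S μ y) := loc_vertexOfK_of_spr hK hS hδs μ y
  have hF : Loc (vertexOfK K n (fun α x => faceWt r n α x • faceSum n S (blk n x)) μ y) := loc_vertexOfK_face hn hr hK hS hδs μ y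
  rw [← vertexOfK_conj_psiKS hn hr hK hS hδs μ y, vertexOfK_conj_psiKS_eq_add hn hr hK hS hδs μ y,
    comp_add_right_tame hΨ.trK.tame hV.tame hF.tame, comp_add_left_tame (hΨ.trK.comp_loc hV).tame (hΨ.trK.comp_loc hF).tame hΨ.tame]
  abel

omit hK hS hδs in
/-- [folklore] **THE FOUR FIBRE BLOCKS OF A LEG-DRESSED KERNEL `Ψ̂ᵀ∘X∘Ψ̂`** (any `X`; leaf-03's leg letters): ff — `slotPsiS` on BOTH field legs. -/
theorem legDress_inl_inl (X : MKer (d + 1) (Fib d)) (x w : Site (d + 1)) (β β' : Fin (d + 1)) :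
    comp (comp (trK (psiKS r n)) X) (psiKS r n) x w (Sum.inl β) (Sum.inl β')
      = slotPsiS r n (fun κ u => slotPsiS r n (fun κ' u' => X u' u (Sum.inl κ') (Sum.inl κ)) β x) β' w := by
  rw [comp_psiKS_inl_right hn hr]
  congr 1
  funext κ u
  exact comp_trK_psiKS_inl_left hn hr X x u β (Sum.inl κ)

omit hK hS hδs in
/-- [folklore] fm — `slotPsiS` on the LEFT field leg only. -/
theorem legDress_inl_inr (X : MKer (d + 1) (Fib d)) (x w : Site (d + 1)) (β m : Fin (d + 1)) :
    comp (comp (trK (psiKS r n)) X) (psiKS r n) x w (Sum.inl β) (Sum.inr m)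
      = slotPsiS r n (fun κ' u' => X u' w (Sum.inl κ') (Sum.inr m)) β x := by
  rw [comp_psiKS_inr_right, comp_trK_psiKS_inl_left hn hr]

omit hK hS hδs in
/-- [folklore] mf — `slotPsiS` on the RIGHT field leg only. -/
theorem legDress_inr_inl (X : MKer (d + 1) (Fib d)) (x w : Site (d + 1)) (m β' : Fin (d + 1)) :
    comp (comp (trK (psiKS r n)) X) (psiKS r n) x w (Sum.inr m) (Sum.inl β')
      = slotPsiS r n (fun κ u => X x u (Sum.inr m) (Sum.inl κ)) β' w := by
  rw [comp_psiKS_inl_right hn hr]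
  congr 1
  funext κ u
  exact comp_trK_psiKS_inr_left X x u m (Sum.inl κ)

omit hn hr hK hS hδs in
/-- [folklore] mm — untouched. -/
theorem legDress_inr_inr (X : MKer (d + 1) (Fib d)) (x w : Site (d + 1)) (m m' : Fin (d + 1)) :
    comp (comp (trK (psiKS r n)) X) (psiKS r n) x w (Sum.inr m) (Sum.inr m') = X x w (Sum.inr m) (Sum.inr m') := by
  rw [comp_psiKS_inr_right, comp_trK_psiKS_inr_left]

end Transport

end Summit.QuantumFields.BalabanUV.Beta.D1BFx.ChartDefectWords

end
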